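import Summits.NavierStokesRegularity.NavierStokesRegularity.Theorems.FilamentSkeletonRssSkeletonJ1RFrameDefs
import Summits.NavierStokesRegularity.NavierStokesRegularity.Theorems.FilamentSkeletonRssSkeletonJ1RSlipTools

/-!
# Route `FilamentSkeletonRss` · crux `SkeletonJ1R` (stmt-NavierStokesRegularity-23610) · stub D `FlatOutputL` — FINE-CLASS TOOLS and the
# FAR-SLIP POSITIVITY (the true slip of a fine skeleton does not vanish off the crux ball)

Consequences of the frame vocabulary of `…SkeletonJ1RFrameDefs` (lead `ns-fsr-lead-23610`, p711824) used by the bookkeeping stub D of the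
registered line `streamline_kantorovich_R` (and of the shelf line `lia_switchoff_degree_R`):
* §1 the DRIFT part of the true slip, `⟪½X τ − α e₃ × X τ, X′ τ⟫`, along a unit-speed curve with tangent oscillation `≤ ε`:
  `(½(1 − ε²/2) − |α|ε)|τ| − (½ + |α|)‖X 0‖ ≤ |drift|` (`abs_drift_ge`) — the chord projects on the tangent, the rotation sees only the
  `ε|τ|`-defect of the chord and the waist offset;
* §2 what `FineClass` + the reference's datum tilt / separation (either frame currency, `Admissible*` or `Sliced*`) give pointwise: datum tilt `‖X_j′ − t_j‖ ≤ 3Rb/8` (`fine_tilt`), tangent oscillation `≤ 3Rb/4`,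
  curvature `‖X_j″‖ ≤ Rb/√Γ`, separation `(ρ/2 − 2Rb)√Γ`, waist norm `‖X_j 0‖ ≤ ‖x_j 0‖ + Rb√Γ`;
* §3 FAR-SLIP: if `|⟪bsField(X_jτ), X_j′τ⟫| ≤ B` for all `τ`, `ε ≤ 1`, `|α|ε ≤ 1/8` and the ball radius `ℓ` exceeds
  `‖X_j 0‖ + 8((½ + |α|)‖X_j 0‖ + B)`, then the TRUE slip `⟪trueField(X_jτ), X_j′τ⟫ ≠ 0` wherever `‖X_j τ‖ > ℓ` (`trueSlip_ne_zero_of_far`).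
HONEST FRAMING: MODEL rung, ∃-side bookkeeping tools about a HYPOTHETICAL filament-type blow-up skeleton; nothing here bears on Navier–Stokes
regularity, which is NOT proved; 23610 stays OPEN. [folklore]
-/

-- `dupNamespace` off: the module name repeats `NavierStokesRegularity` by the tree's `Summits/<S>/<S>/Theorems` layout (same as every sibling file).
set_option linter.dupNamespace false

noncomputable section

namespace Summit.NavierStokesRegularity.NavierStokesRegularity.Theorems.SkeletonJ1RFlatOutput

open MeasureTheory Filter Topology
open Literature.Analysis.FluidPDE Literature.Analysis.FluidPDE.Tao2016
open Summit.NavierStokesRegularity.NavierStokesRegularity.Theorems.SkeletonJ1RFrame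
open Summit.NavierStokesRegularity.NavierStokesRegularity.Theorems.SkeletonJ1RSlipTools
open scoped RealInnerProductSpace InnerProductSpace BigOperators

/-! ## §1 The drift part of the true slip along a near-straight curve -/

/-- `|⟪e₃ × v, T⟫| ≤ ‖v‖` for a unit vector `T`. [folklore] -/
private theorem abs_inner_e3_cross_le (v T : EuclideanSpace ℝ (Fin 3)) (hT : ‖T‖ = 1) :
    |⟪cross (EuclideanSpace.single 2 1) v, T⟫| ≤ ‖v‖ := by
  have h1 := abs_real_inner_le_norm (cross (EuclideanSpace.single 2 1) v) T
  have he : ‖(EuclideanSpace.single (2 : Fin 3) (1 : ℝ))‖ = 1 := by simp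
  have h2 : ‖cross (EuclideanSpace.single 2 1) v‖ ≤ ‖v‖ := by
    rw [norm_cross, he, one_mul]
    exact mul_le_of_le_one_right (norm_nonneg _) (Real.sin_le_one _)
  rw [hT, mul_one] at h1
  exact h1.trans h2

/-- The rotation does not see the tangential part: `⟪e₃ × (a • T + R), T⟫ = ⟪e₃ × R, T⟫`. [folklore] -/
private theorem inner_e3_cross_smul_add (a : ℝ) (T R : EuclideanSpace ℝ (Fin 3)) :
    ⟪cross (EuclideanSpace.single 2 1) (a • T + R), T⟫ = ⟪cross (EuclideanSpace.single 2 1) R, T⟫ := by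
  rw [cross_add_right, cross_smul_right, inner_add_left, inner_smul_left, inner_cross_self_right]
  simp

/-- **Drift lower bound.**  Along a `C¹` unit-speed curve with tangent oscillation `‖X′u − X′v‖ ≤ ε`, the drift part of the true slip obeys
`(½(1 − ε²/2) − |α|ε)·|τ| − (½ + |α|)‖X 0‖ ≤ |⟪½X τ − α e₃ × X τ, X′ τ⟫|`. [folklore] -/
theorem abs_drift_ge {X : ℝ → EuclideanSpace ℝ (Fin 3)} (hX : ContDiff ℝ 1 X) (hunit : ∀ s, ‖deriv X s‖ = 1) {ε : ℝ}
    (hosc : ∀ u v, ‖deriv X u - deriv X v‖ ≤ ε) (α τ : ℝ) :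
    (1 / 2 * (1 - ε ^ 2 / 2) - |α| * ε) * |τ| - (1 / 2 + |α|) * ‖X 0‖ ≤
      |⟪(1/2:ℝ) • X τ - α • cross (EuclideanSpace.single 2 1) (X τ), deriv X τ⟫| := by
  set T := deriv X τ with hT
  have hT1 : ‖T‖ = 1 := hunit τ
  -- decomposition X τ = X 0 + (τ • T + R) with ‖R‖ ≤ ε |τ|
  set R := X τ - X 0 - τ • T with hR
  have hRle : ‖R‖ ≤ ε * |τ| := by
    have := norm_chord_sub_smul_deriv_le_of_osc hX hosc τ 0 τ
    rw [sub_zero, ← hT] at this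
    exact this
  have hXτ : X τ = X 0 + (τ • T + R) := by rw [hR]; abel
  -- the four pieces
  have h0 : |⟪X 0, T⟫| ≤ ‖X 0‖ := by simpa [hT1] using abs_real_inner_le_norm (X 0) T
  have h1 : |⟪cross (EuclideanSpace.single 2 1) (X 0), T⟫| ≤ ‖X 0‖ := abs_inner_e3_cross_le _ _ hT1
  have h2 : |⟪cross (EuclideanSpace.single 2 1) (τ • T + R), T⟫| ≤ ε * |τ| := by
    rw [inner_e3_cross_smul_add]
    exact (abs_inner_e3_cross_le R T hT1).trans hRle
  -- the chord projects on the tangent with the sign of τ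
  have h3 : (1 - ε ^ 2 / 2) * |τ| ≤ |⟪τ • T + R, T⟫| := by
    have hchord : τ • T + R = X τ - X 0 := by rw [hR]; abel
    rw [hchord]
    rcases le_or_gt 0 τ with hτ | hτ
    · have := inner_chord_deriv_ge_of_osc hX hunit hosc hτ τ
      rw [sub_zero] at this
      rw [abs_of_nonneg hτ]
      exact this.trans (le_abs_self _)
    · have := inner_chord_deriv_ge_of_osc hX hunit hosc hτ.le τ
      rw [zero_sub, ← hT] at this
      rw [abs_of_neg hτ]
      have h' : ⟪X 0 - X τ, T⟫ = -⟪X τ - X 0, T⟫ := by rw [← inner_neg_left]; congr 1; abel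
      rw [h'] at this
      exact this.trans (neg_le_abs _)
  -- assemble
  have hexp : ⟪(1/2:ℝ) • X τ - α • cross (EuclideanSpace.single 2 1) (X τ), T⟫ =
      1/2 * ⟪X 0, T⟫ + 1/2 * ⟪τ • T + R, T⟫ - α * ⟪cross (EuclideanSpace.single 2 1) (X 0), T⟫ -
        α * ⟪cross (EuclideanSpace.single 2 1) (τ • T + R), T⟫ := by
    rw [hXτ]
    simp only [inner_sub_left, inner_add_left, real_inner_smul_left, cross_add_right]
    ring
  rw [hexp]
  have hα := abs_nonneg α
  have hε : 0 ≤ ε := le_trans (norm_nonneg _) (hosc 0 0)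
  -- |a + b - c - d| ≥ |b|/… : use |x| ≥ x and |x| ≥ -x on the main term
  have key : 1/2 * |⟪τ • T + R, T⟫| - (1/2 * ‖X 0‖ + |α| * ‖X 0‖ + |α| * (ε * |τ|)) ≤
      |1/2 * ⟪X 0, T⟫ + 1/2 * ⟪τ • T + R, T⟫ - α * ⟪cross (EuclideanSpace.single 2 1) (X 0), T⟫ -
        α * ⟪cross (EuclideanSpace.single 2 1) (τ • T + R), T⟫| := by
    have e1 : |α * ⟪cross (EuclideanSpace.single 2 1) (X 0), T⟫| ≤ |α| * ‖X 0‖ := by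
      rw [abs_mul]; exact mul_le_mul_of_nonneg_left h1 hα
    have e2 : |α * ⟪cross (EuclideanSpace.single 2 1) (τ • T + R), T⟫| ≤ |α| * (ε * |τ|) := by
      rw [abs_mul]; exact mul_le_mul_of_nonneg_left h2 hα
    have e0 : |1/2 * ⟪X 0, T⟫| ≤ 1/2 * ‖X 0‖ := by
      rw [abs_mul, abs_of_pos (by norm_num : (0:ℝ) < 1/2)]; exact mul_le_mul_of_nonneg_left h0 (by norm_num)
    have emain : |1/2 * ⟪τ • T + R, T⟫| = 1/2 * |⟪τ • T + R, T⟫| := by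
      rw [abs_mul, abs_of_pos (by norm_num : (0:ℝ) < 1/2)]
    -- reverse triangle inequality
    have tri := abs_sub_abs_le_abs_sub (1/2 * ⟪τ • T + R, T⟫)
      (-(1/2 * ⟪X 0, T⟫) + α * ⟪cross (EuclideanSpace.single 2 1) (X 0), T⟫ +
        α * ⟪cross (EuclideanSpace.single 2 1) (τ • T + R), T⟫)
    have tri2 : |-(1/2 * ⟪X 0, T⟫) + α * ⟪cross (EuclideanSpace.single 2 1) (X 0), T⟫ +
        α * ⟪cross (EuclideanSpace.single 2 1) (τ • T + R), T⟫| ≤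
        1/2 * ‖X 0‖ + |α| * ‖X 0‖ + |α| * (ε * |τ|) := by
      refine (abs_add_three _ _ _).trans ?_
      rw [abs_neg]
      linarith
    have hrw : 1/2 * ⟪τ • T + R, T⟫ - (-(1/2 * ⟪X 0, T⟫) + α * ⟪cross (EuclideanSpace.single 2 1) (X 0), T⟫ +
        α * ⟪cross (EuclideanSpace.single 2 1) (τ • T + R), T⟫) =
        1/2 * ⟪X 0, T⟫ + 1/2 * ⟪τ • T + R, T⟫ - α * ⟪cross (EuclideanSpace.single 2 1) (X 0), T⟫ -
        α * ⟪cross (EuclideanSpace.single 2 1) (τ • T + R), T⟫ := by ring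
    rw [hrw, emain] at tri
    linarith
  nlinarith [key, h3, mul_nonneg hα hε, abs_nonneg τ, norm_nonneg (X 0)]

/-! ## §2 Pointwise consequences of the fine class in an admissible frame -/

/-- `iteratedDeriv 2 f = deriv (deriv f)`. [folklore] -/
private theorem iteratedDeriv_two_eq' (f : ℝ → EuclideanSpace ℝ (Fin 3)) : iteratedDeriv 2 f = deriv (deriv f) := by
  rw [iteratedDeriv_succ, iteratedDeriv_one]

/-- Datum tilt of a fine skeleton: `‖X_j′ τ − t_j‖ ≤ 3Rb/8` (fine tilt `Rb/4` against the reference + reference tilt `Rb/8`). [folklore] -/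
theorem fine_tilt {N : ℕ} {Γ δ Λ Rb : ℝ} {γ : Fin N → ℝ} {α : ℝ} {t : Fin N → EuclideanSpace ℝ (Fin 3)}
    {x X : Fin N → ℝ → EuclideanSpace ℝ (Fin 3)} (hfine : FineClass Γ δ Λ Rb γ α x X) (hreft : ∀ j τ, ‖deriv (x j) τ - t j‖ ≤ Rb / 8)
    (j : Fin N) (τ : ℝ) : ‖deriv (X j) τ - t j‖ ≤ 3 * Rb / 8 := by
  obtain ⟨σ, -, hσ⟩ := (hfine j).1 τ
  have h2 := hreft j σ
  calc ‖deriv (X j) τ - t j‖ = ‖(deriv (X j) τ - deriv (x j) σ) + (deriv (x j) σ - t j)‖ := by congr 1; abel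
    _ ≤ ‖deriv (X j) τ - deriv (x j) σ‖ + ‖deriv (x j) σ - t j‖ := norm_add_le _ _
    _ ≤ Rb / 4 + Rb / 8 := add_le_add hσ h2
    _ = 3 * Rb / 8 := by ring

/-- Tangent oscillation of a fine skeleton: `‖X_j′ u − X_j′ v‖ ≤ 3Rb/4`. [folklore] -/
theorem fine_osc {N : ℕ} {Γ δ Λ Rb : ℝ} {γ : Fin N → ℝ} {α : ℝ} {t : Fin N → EuclideanSpace ℝ (Fin 3)}
    {x X : Fin N → ℝ → EuclideanSpace ℝ (Fin 3)} (hfine : FineClass Γ δ Λ Rb γ α x X) (hreft : ∀ j τ, ‖deriv (x j) τ - t j‖ ≤ Rb / 8)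
    (j : Fin N) (u v : ℝ) : ‖deriv (X j) u - deriv (X j) v‖ ≤ 3 * Rb / 4 := by
  calc ‖deriv (X j) u - deriv (X j) v‖ = ‖(deriv (X j) u - t j) - (deriv (X j) v - t j)‖ := by congr 1; abel
    _ ≤ ‖deriv (X j) u - t j‖ + ‖deriv (X j) v - t j‖ := norm_sub_le _ _
    _ ≤ 3 * Rb / 8 + 3 * Rb / 8 := add_le_add (fine_tilt hfine hreft j u) (fine_tilt hfine hreft j v)
    _ = 3 * Rb / 4 := by ring

/-- Curvature of a fine skeleton on the outer scale: `‖X_j″ s‖ ≤ Rb/√Γ` (`0 < Γ`). [folklore] -/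
theorem fine_curv {N : ℕ} {Γ δ Λ Rb : ℝ} {γ : Fin N → ℝ} {α : ℝ} {x X : Fin N → ℝ → EuclideanSpace ℝ (Fin 3)}
    (hfine : FineClass Γ δ Λ Rb γ α x X) (hΓ : 0 < Γ) (j : Fin N) (s : ℝ) :
    ‖deriv (deriv (X j)) s‖ ≤ Rb / Real.sqrt Γ := by
  have h := (hfine j).2.2.1 s
  rw [iteratedDeriv_two_eq'] at h
  rwa [le_div_iff₀ (Real.sqrt_pos.2 hΓ)]

/-- Separation of a fine skeleton: `(ρ/2 − 2Rb)√Γ ≤ ‖X_j τ − X_k σ‖` for `j ≠ k`. [folklore] -/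
theorem fine_sep {N : ℕ} {Γ δ Λ Rb ρ : ℝ} {γ : Fin N → ℝ} {α : ℝ}
    {x X : Fin N → ℝ → EuclideanSpace ℝ (Fin 3)} (hfine : FineClass Γ δ Λ Rb γ α x X)
    (hrefsep : ∀ j k, j ≠ k → ∀ τ σ, ρ / 2 * Real.sqrt Γ ≤ ‖x j τ - x k σ‖)
    {j k : Fin N} (hjk : j ≠ k) (τ σ : ℝ) : (ρ / 2 - 2 * Rb) * Real.sqrt Γ ≤ ‖X j τ - X k σ‖ := by
  obtain ⟨τ', hτ', -⟩ := (hfine j).1 τ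
  obtain ⟨σ', hσ', -⟩ := (hfine k).1 σ
  have hsep := hrefsep j k hjk τ' σ'
  have : ‖x j τ' - x k σ'‖ ≤ ‖X j τ - x j τ'‖ + ‖X j τ - X k σ‖ + ‖X k σ - x k σ'‖ := by
    calc ‖x j τ' - x k σ'‖ = ‖-(X j τ - x j τ') + (X j τ - X k σ) + (X k σ - x k σ')‖ := by congr 1; abel
      _ ≤ ‖-(X j τ - x j τ')‖ + ‖X j τ - X k σ‖ + ‖X k σ - x k σ'‖ := norm_add₃_le
      _ = _ := by rw [norm_neg]
  linarith

/-- Waist norm of a fine skeleton: `‖X_j 0‖ ≤ ‖x_j 0‖ + Rb√Γ`. [folklore] -/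
theorem fine_waist_norm {N : ℕ} {Γ δ Λ Rb : ℝ} {γ : Fin N → ℝ} {α : ℝ} {x X : Fin N → ℝ → EuclideanSpace ℝ (Fin 3)}
    (hfine : FineClass Γ δ Λ Rb γ α x X) (j : Fin N) : ‖X j 0‖ ≤ ‖x j 0‖ + Rb * Real.sqrt Γ := by
  have h := (hfine j).2.1
  have : ‖X j 0‖ ≤ ‖X j 0 - x j 0‖ + ‖x j 0‖ := by
    calc ‖X j 0‖ = ‖(X j 0 - x j 0) + x j 0‖ := by congr 1; abel
      _ ≤ _ := norm_add_le _ _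
  linarith

/-- Unit speed is `1`-Lipschitz: `‖X u − X t‖ ≤ |u − t|`. [folklore] -/
theorem norm_sub_le_of_unit {X : ℝ → EuclideanSpace ℝ (Fin 3)} (hX : ContDiff ℝ 1 X) (hunit : ∀ s, ‖deriv X s‖ = 1) (u t : ℝ) :
    ‖X u - X t‖ ≤ |u - t| := by
  have hd : Differentiable ℝ X := hX.differentiable one_ne_zero
  have := Convex.norm_image_sub_le_of_norm_deriv_le (s := Set.univ) (fun x _ => hd x)
    (fun x _ => (hunit x).le) convex_univ (Set.mem_univ t) (Set.mem_univ u)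
  rw [← Real.norm_eq_abs]; simpa using this

/-! ## §3 Far-slip positivity -/

/-- **The true slip does not vanish off the crux ball.**  Let `X_j` be `C¹`, unit speed, with tangent oscillation `≤ ε ≤ 1`, `|α|ε ≤ 1/8`, and let
the tangential Biot–Savart part be bounded, `|⟪bsField(X_jτ), X_j′τ⟫| ≤ B` for all `τ`.  If the ball radius satisfies
`‖X_j 0‖ + 8((½ + |α|)‖X_j 0‖ + B) < ℓ`, then `⟪trueField Γ γ α X (X_j τ), X_j′ τ⟫ ≠ 0` whenever `ℓ < ‖X_j τ‖`. [folklore] -/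
theorem trueSlip_ne_zero_of_far {N : ℕ} {Γ : ℝ} {γ : Fin N → ℝ} {α : ℝ} {X : Fin N → ℝ → EuclideanSpace ℝ (Fin 3)} {j : Fin N}
    (hX : ContDiff ℝ 1 (X j)) (hunit : ∀ s, ‖deriv (X j) s‖ = 1) {ε B ℓ : ℝ} (hosc : ∀ u v, ‖deriv (X j) u - deriv (X j) v‖ ≤ ε)
    (hε1 : ε ≤ 1) (hαε : |α| * ε ≤ 1 / 8) (hB : ∀ τ, |⟪bsField Γ γ X (X j τ), deriv (X j) τ⟫| ≤ B)
    (hℓ : ‖X j 0‖ + 8 * ((1 / 2 + |α|) * ‖X j 0‖ + B) < ℓ) {τ : ℝ} (hτ : ℓ < ‖X j τ‖) :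
    ⟪trueField Γ γ α X (X j τ), deriv (X j) τ⟫ ≠ 0 := by
  have hε : 0 ≤ ε := le_trans (norm_nonneg _) (hosc 0 0)
  -- |τ| is large
  have hτabs : ℓ - ‖X j 0‖ < |τ| := by
    have h1 := norm_sub_le_of_unit hX hunit τ 0
    rw [sub_zero] at h1
    have h2 : ‖X j τ‖ ≤ ‖X j τ - X j 0‖ + ‖X j 0‖ := by
      calc ‖X j τ‖ = ‖(X j τ - X j 0) + X j 0‖ := by congr 1; abel
        _ ≤ _ := norm_add_le _ _
    linarith
  -- the drift dominates
  have hdrift := abs_drift_ge hX hunit hosc α τ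
  have hcoef : 1 / 8 ≤ 1 / 2 * (1 - ε ^ 2 / 2) - |α| * ε := by nlinarith [hε, hε1, hαε]
  have hdrift' : 1 / 8 * |τ| - (1 / 2 + |α|) * ‖X j 0‖ ≤
      |⟪(1/2:ℝ) • X j τ - α • cross (EuclideanSpace.single 2 1) (X j τ), deriv (X j) τ⟫| :=
    le_trans (by nlinarith [abs_nonneg τ]) hdrift
  -- the true slip = Biot–Savart part + drift
  have hsplit : ⟪trueField Γ γ α X (X j τ), deriv (X j) τ⟫ = ⟪bsField Γ γ X (X j τ), deriv (X j) τ⟫ +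
      ⟪(1/2:ℝ) • X j τ - α • cross (EuclideanSpace.single 2 1) (X j τ), deriv (X j) τ⟫ := by
    unfold trueField; rw [← inner_add_left]; congr 1; abel
  intro hzero
  rw [hsplit] at hzero
  have hb := hB τ
  have : |⟪(1/2:ℝ) • X j τ - α • cross (EuclideanSpace.single 2 1) (X j τ), deriv (X j) τ⟫| ≤ B := by
    have : ⟪(1/2:ℝ) • X j τ - α • cross (EuclideanSpace.single 2 1) (X j τ), deriv (X j) τ⟫ =
        -⟪bsField Γ γ X (X j τ), deriv (X j) τ⟫ := by linarith
    rw [this, abs_neg]; exact hb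
  have hα : 0 ≤ 1 / 2 + |α| := by positivity
  nlinarith [this, hdrift', hτabs, hℓ, mul_nonneg hα (norm_nonneg (X j 0))]

end Summit.NavierStokesRegularity.NavierStokesRegularity.Theorems.SkeletonJ1RFlatOutput

end
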